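import Summits.Ventures.HSemireg.WedgeHankelRecurrenceGaussJacobiTrace

/-!
# Venture HSemireg — **THE NORMS `h_k = b_1 ⋯ b_k h_0` AND THE CHRISTOFFEL–DARBOUX FORM OF THE KERNEL**: for the orthogonal polynomials of a positive discrete measure obeying
# `q_{k+2} = (X − a_{k+1}) q_{k+1} − b_{k+1} q_k`, `h_{k+1} = b_{k+1} h_k` (`h_k = Σ_l ν_l q_k(w_l)²`), so the `h`-normalised kernel of N277 is the `b`-weighted sum of N274:
# `h_n K_n(x, y) (x − y) = q_{n+1}(x) q_n(y) − q_n(x) q_{n+1}(y)`, `h_n K_n(y, y) = q_{n+1}′(y) q_n(y) − q_n′(y) q_{n+1}(y)`, and the CHRISTOFFEL FUNCTION IN CLOSED FORM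
# `λ_n(y) = h_n ∕ (q_{n+1}′(y) q_n(y) − q_n′(y) q_{n+1}(y))`, which bounds the mass of every point: `ν{y} ≤ λ_n(y)`

HONEST FRAMING. Part of the Lean index of the computation cell `pub-hsemireg` (seat p10 gen 43, Sunday typer «UNIFORM-IN-n»).  Real polynomials, their derivatives and finite sums only; no variety, no
cohomology theory, no sheaf, no Ext group and no semiregularity map is constructed here; nothing here says that HC / HC_CM / HC_AV holds; no Literature fact (unproved `Prop`) is declared or used.
Custodian versions as in `WedgeHankelSiegelIdeal` (1/3).
SOURCES (cited).  E. B. Christoffel, J. reine angew. Math. 55 (1858) 61–82; G. Darboux, J. Math. Pures Appl. (3) 4 (1878) 5–56, 377–416; G. Szegő, *Orthogonal Polynomials*, Thm 3.2.2 and (3.2.4)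
(Christoffel–Darboux and its confluent form), Thm 3.1.3 (Christoffel function); T. S. Chihara, *An Introduction to Orthogonal Polynomials* (1978), Ch. I Thm 4.2 (c) («`h_{n+1} = λ_{n+1} h_n`»),
Thm 4.5–4.6; G. Freud, *Orthogonal Polynomials* (1971), §I.4; N. I. Akhiezer, *The Classical Moment Problem*, Thm 2.5.3.
PROOF TYPED HERE.  `h_{k+1} = Σ ν q_{k+1} · X q_k` (N273 `sum_mul_eval_mul_eq_sum_sq_of_monic` with `a = 0`) and `X q_{k+1} = q_{k+2} + a_{k+1} q_{k+1} + b_{k+1} q_k`, the first two terms being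
orthogonal to `q_k`; then `h_n = (∏_{k<j≤n} b_j) h_k` by `Nat.le_induction`, which converts N274's sums `Σ_k (∏_{k<j≤n} b_j) q_k(x) q_k(y)` into `h_n Σ_k q_k(x) q_k(y) ∕ h_k`; the closed
form of `λ_n` and the atom bound are N296 `atom_mass_mul_kernel_le_one` rewritten.
DEDUP DISCLOSURE (`rg -n 'sum_sq_succ_eq|kernel_diag_mul_norm|christoffel_function_eq|cd_kernel' Summits Literature`, 2026-09-03): N274 is Christoffel–Darboux for the `b`-weighted sums of a
recurrence (no measure); N277 ∕ N296 use the `h`-normalised kernel of a measure (no recurrence); this file is the bridge.  The 7 names below: 0 hits tree-wide.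

WHAT IS IN THE TREE.  N273 `sum_mul_eval_mul_eq_sum_sq_of_monic`, `sum_mul_eval_sq_pos_of_natDegree_lt`; N274 `recurrence_christoffel_darboux`, `recurrence_christoffel_darboux_confluent`,
(`recurrence_christoffel_darboux_confluent_pos` cited); N279 `recurrence_monic_natDegree`; N296 `atom_mass_mul_kernel_le_one`, `kernelPoly_eval_self_eq`; Mathlib `Finset.prod_Ico_succ_top`, `Nat.le_induction`.
THIS FILE (namespace `Summit.Ventures.HSemireg.Wedge.HankelOuter` continued; CHAINED on N298 (import), N273, N274, N279, N296; 0 definitions):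
* §1064 **`sum_sq_succ_eq_b_mul_sum_sq`** (`h_{k+1} = b_{k+1} h_k`), `sum_sq_eq_prod_Ico_mul_sum_sq` (`h_n = (∏_{k<j≤n} b_j) h_k`), **`norm_mul_kernel_eq_cd_sum`** (`h_n Σ_k q_k(x)q_k(y)∕h_k = Σ_k (∏ b) q_k(x)q_k(y)`),
  **`christoffel_darboux_kernel`** (`h_n (x − y) K_n(x, y) = q_{n+1}(x)q_n(y) − q_n(x)q_{n+1}(y)`), **`christoffel_darboux_kernel_diag`** (`h_n K_n(y, y) = q_{n+1}′(y)q_n(y) − q_n′(y)q_{n+1}(y)`),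
  **`christoffel_function_closed_form`** (`1 ∕ K_n(y, y) = h_n ∕ (q_{n+1}′ q_n − q_n′ q_{n+1})(y)`), **`atom_mass_le_christoffel_closed_form`** (`ν{y} ≤ h_n ∕ (q_{n+1}′(y) q_n(y) − q_n′(y) q_{n+1}(y))` for every
  real `y`).
CAVEATS.  Positive discrete measures with `N > n + 1` atoms; the recurrence is assumed to extend the orthogonal system (as supplied by N295 `exists_positive_recurrence_of_orthogonal`).  Nothing Ext-side.
New names only.
-/

open Module Polynomial
open scoped Matrix Polynomial

namespace Summit.Ventures.HSemireg.Wedge.HankelOuter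

/-! ## §1064. `h_{k+1} = b_{k+1} h_k` and the Christoffel–Darboux form of the kernel -/

/-- **`h_{k+1} = b_{k+1} h_k`**: if `q` obeys the recurrence `(a, b)` and `q_k, q_{k+1}, q_{k+2}` are `(ν, w)`-orthogonal to all lower degrees, then
`Σ_l ν_l q_{k+1}(w_l)² = b_{k+1} Σ_l ν_l q_k(w_l)²`. [Chihara I Thm 4.2 (c); Szegő (3.2.3); this file, §1064] -/
theorem sum_sq_succ_eq_b_mul_sum_sq {N : ℕ} {ν w : Fin N → ℝ} {q : ℕ → ℝ[X]} {a b : ℕ → ℝ} (hq0 : q 0 = 1) (hq1 : q 1 = Polynomial.X - C (a 0))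
    (hrec : ∀ n, q (n + 2) = (Polynomial.X - C (a (n + 1))) * q (n + 1) - C (b (n + 1)) * q n) (k : ℕ)
    (horth1 : ∀ G : ℝ[X], G.natDegree < k + 1 → ∑ l, ν l * (q (k + 1) * G).eval (w l) = 0)
    (horth2 : ∀ G : ℝ[X], G.natDegree < k + 2 → ∑ l, ν l * (q (k + 2) * G).eval (w l) = 0) :
    ∑ l, ν l * ((q (k + 1)).eval (w l)) ^ 2 = b (k + 1) * ∑ l, ν l * ((q k).eval (w l)) ^ 2 := by
  have hmd := recurrence_monic_natDegree hq0 hq1 hrec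
  -- `h_{k+1} = Σ ν q_{k+1} · (X q_k)`
  have h1 := sum_mul_eval_mul_eq_sum_sq_of_monic (ν := ν) (w := w) (m := k + 1) (by omega) (hmd k).1 (by rw [(hmd k).2]; omega) (hmd (k + 1)).1 (hmd (k + 1)).2 horth1 0
  rw [← h1]
  -- `X q_{k+1} = q_{k+2} + a_{k+1} q_{k+1} + b_{k+1} q_k`, tested against `q_k`
  have hX : ∀ l, ν l * ((q (k + 1)).eval (w l) * ((Polynomial.X - C (0 : ℝ)) * q k).eval (w l)) =
      ν l * (q (k + 2) * q k).eval (w l) + a (k + 1) * (ν l * (q (k + 1) * q k).eval (w l)) + b (k + 1) * (ν l * ((q k).eval (w l)) ^ 2) := fun l => by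
    rw [hrec k]
    simp only [map_zero, sub_zero, eval_mul, eval_sub, eval_X, eval_C]
    ring
  rw [Finset.sum_congr rfl fun l _ => hX l, Finset.sum_add_distrib, Finset.sum_add_distrib, ← Finset.mul_sum, ← Finset.mul_sum,
    horth2 (q k) (by rw [(hmd k).2]; omega), horth1 (q k) (by rw [(hmd k).2]; omega), mul_zero, zero_add, zero_add]

/-- **`h_n = (∏_{k < j ≤ n} b_j) h_k`** for `k ≤ n`, when `q_0, …, q_{n+1}` are orthogonal. [Chihara I Thm 4.2 (c); this file, §1064] -/
theorem sum_sq_eq_prod_Ico_mul_sum_sq {N m : ℕ} {ν w : Fin N → ℝ} {q : ℕ → ℝ[X]} {a b : ℕ → ℝ} (hq0 : q 0 = 1) (hq1 : q 1 = Polynomial.X - C (a 0))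
    (hrec : ∀ n, q (n + 2) = (Polynomial.X - C (a (n + 1))) * q (n + 1) - C (b (n + 1)) * q n)
    (horth : ∀ k, k ≤ m → ∀ G : ℝ[X], G.natDegree < k → ∑ l, ν l * (q k * G).eval (w l) = 0) {k n : ℕ} (hkn : k ≤ n) (hn : n + 1 ≤ m) :
    ∑ l, ν l * ((q n).eval (w l)) ^ 2 = (∏ j ∈ Finset.Ico (k + 1) (n + 1), b j) * ∑ l, ν l * ((q k).eval (w l)) ^ 2 := by
  induction n, hkn using Nat.le_induction with
  | base => rw [Finset.Ico_self, Finset.prod_empty, one_mul]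
  | succ n hkn ih =>
    rw [sum_sq_succ_eq_b_mul_sum_sq hq0 hq1 hrec n (horth (n + 1) (by omega)) (horth (n + 2) (by omega)), ih (by omega), Finset.prod_Ico_succ_top (by omega : k + 1 ≤ n + 1)]
    ring

/-- **The `h`-normalised kernel is the `b`-weighted sum**: `h_n · Σ_{k≤n} q_k(x) q_k(y) ∕ h_k = Σ_{k≤n} (∏_{k<j≤n} b_j) q_k(x) q_k(y)` (positive measure, `n + 1 ≤ m < N`).
[Szegő (3.2.3)–(3.2.4); this file, §1064] -/
theorem norm_mul_kernel_eq_cd_sum {N m : ℕ} {ν w : Fin N → ℝ} (hν : ∀ l, 0 < ν l) (hw : Function.Injective w) (hmN : m < N) {q : ℕ → ℝ[X]} {a b : ℕ → ℝ} (hq0 : q 0 = 1)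
    (hq1 : q 1 = Polynomial.X - C (a 0)) (hrec : ∀ n, q (n + 2) = (Polynomial.X - C (a (n + 1))) * q (n + 1) - C (b (n + 1)) * q n)
    (horth : ∀ k, k ≤ m → ∀ G : ℝ[X], G.natDegree < k → ∑ l, ν l * (q k * G).eval (w l) = 0) {n : ℕ} (hn : n + 1 ≤ m) (x y : ℝ) :
    (∑ l, ν l * ((q n).eval (w l)) ^ 2) * ∑ k ∈ Finset.range (n + 1), (q k).eval x * (q k).eval y / ∑ l, ν l * ((q k).eval (w l)) ^ 2 =
      ∑ k ∈ Finset.range (n + 1), (∏ j ∈ Finset.Ico (k + 1) (n + 1), b j) * ((q k).eval x * (q k).eval y) := by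
  have hmd := recurrence_monic_natDegree hq0 hq1 hrec
  have hh : ∀ k, k ≤ m → ∑ l, ν l * ((q k).eval (w l)) ^ 2 ≠ 0 := fun k hk =>
    (sum_mul_eval_sq_pos_of_natDegree_lt hν hw (hmd k).1.ne_zero (by rw [(hmd k).2]; omega)).ne'
  rw [Finset.mul_sum]
  refine Finset.sum_congr rfl fun k hk => ?_
  have hkn : k ≤ n := Nat.lt_succ_iff.1 (Finset.mem_range.1 hk)
  rw [sum_sq_eq_prod_Ico_mul_sum_sq hq0 hq1 hrec horth hkn hn, mul_assoc, ← mul_div_assoc, mul_div_cancel_left₀ _ (hh k (by omega))]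

/-- **CHRISTOFFEL–DARBOUX FOR THE KERNEL OF A MEASURE**: `h_n (x − y) Σ_{k≤n} q_k(x) q_k(y) ∕ h_k = q_{n+1}(x) q_n(y) − q_n(x) q_{n+1}(y)`. [Szegő Thm 3.2.2; Chihara I Thm 4.5; this file, §1064] -/
theorem christoffel_darboux_kernel {N m : ℕ} {ν w : Fin N → ℝ} (hν : ∀ l, 0 < ν l) (hw : Function.Injective w) (hmN : m < N) {q : ℕ → ℝ[X]} {a b : ℕ → ℝ} (hq0 : q 0 = 1)
    (hq1 : q 1 = Polynomial.X - C (a 0)) (hrec : ∀ n, q (n + 2) = (Polynomial.X - C (a (n + 1))) * q (n + 1) - C (b (n + 1)) * q n)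
    (horth : ∀ k, k ≤ m → ∀ G : ℝ[X], G.natDegree < k → ∑ l, ν l * (q k * G).eval (w l) = 0) {n : ℕ} (hn : n + 1 ≤ m) (x y : ℝ) :
    (∑ l, ν l * ((q n).eval (w l)) ^ 2) * ((x - y) * ∑ k ∈ Finset.range (n + 1), (q k).eval x * (q k).eval y / ∑ l, ν l * ((q k).eval (w l)) ^ 2) =
      (q (n + 1)).eval x * (q n).eval y - (q n).eval x * (q (n + 1)).eval y := by
  rw [mul_left_comm, norm_mul_kernel_eq_cd_sum hν hw hmN hq0 hq1 hrec horth hn x y]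
  exact recurrence_christoffel_darboux hq0 hq1 hrec n x y

/-- **Confluent form: `h_n K_n(y, y) = q_{n+1}′(y) q_n(y) − q_n′(y) q_{n+1}(y)`** (`K_n(y, y) = Σ_{k≤n} q_k(y)² ∕ h_k`). [Szegő (3.2.4); Chihara I Thm 4.6; this file, §1064] -/
theorem christoffel_darboux_kernel_diag {N m : ℕ} {ν w : Fin N → ℝ} (hν : ∀ l, 0 < ν l) (hw : Function.Injective w) (hmN : m < N) {q : ℕ → ℝ[X]} {a b : ℕ → ℝ} (hq0 : q 0 = 1)
    (hq1 : q 1 = Polynomial.X - C (a 0)) (hrec : ∀ n, q (n + 2) = (Polynomial.X - C (a (n + 1))) * q (n + 1) - C (b (n + 1)) * q n)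
    (horth : ∀ k, k ≤ m → ∀ G : ℝ[X], G.natDegree < k → ∑ l, ν l * (q k * G).eval (w l) = 0) {n : ℕ} (hn : n + 1 ≤ m) (y : ℝ) :
    (∑ l, ν l * ((q n).eval (w l)) ^ 2) * ∑ k ∈ Finset.range (n + 1), ((q k).eval y) ^ 2 / ∑ l, ν l * ((q k).eval (w l)) ^ 2 =
      (derivative (q (n + 1))).eval y * (q n).eval y - (derivative (q n)).eval y * (q (n + 1)).eval y := by
  have h := norm_mul_kernel_eq_cd_sum hν hw hmN hq0 hq1 hrec horth hn y y
  simp only [← sq] at h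
  rw [h]
  exact recurrence_christoffel_darboux_confluent hq0 hq1 hrec n y

/-- **THE CHRISTOFFEL FUNCTION IN CLOSED FORM**: `λ_n(y) = 1 ∕ K_n(y, y) = h_n ∕ (q_{n+1}′(y) q_n(y) − q_n′(y) q_{n+1}(y))` (the denominator is `h_n K_n(y, y) > 0`; for a positive recurrence its
positivity is also N274 `recurrence_christoffel_darboux_confluent_pos`).
[Szegő Thm 3.1.3 + (3.2.4); Freud §I.4; this file, §1064] -/
theorem christoffel_function_closed_form {N m : ℕ} {ν w : Fin N → ℝ} (hν : ∀ l, 0 < ν l) (hw : Function.Injective w) (hmN : m < N) {q : ℕ → ℝ[X]} {a b : ℕ → ℝ} (hq0 : q 0 = 1)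
    (hq1 : q 1 = Polynomial.X - C (a 0)) (hrec : ∀ n, q (n + 2) = (Polynomial.X - C (a (n + 1))) * q (n + 1) - C (b (n + 1)) * q n)
    (horth : ∀ k, k ≤ m → ∀ G : ℝ[X], G.natDegree < k → ∑ l, ν l * (q k * G).eval (w l) = 0) {n : ℕ} (hn : n + 1 ≤ m) (y : ℝ) :
    1 / ∑ k ∈ Finset.range (n + 1), ((q k).eval y) ^ 2 / ∑ l, ν l * ((q k).eval (w l)) ^ 2 =
      (∑ l, ν l * ((q n).eval (w l)) ^ 2) / ((derivative (q (n + 1))).eval y * (q n).eval y - (derivative (q n)).eval y * (q (n + 1)).eval y) := by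
  have hmd := recurrence_monic_natDegree hq0 hq1 hrec
  have hhn : 0 < ∑ l, ν l * ((q n).eval (w l)) ^ 2 := sum_mul_eval_sq_pos_of_natDegree_lt hν hw (hmd n).1.ne_zero (by rw [(hmd n).2]; omega)
  rw [← christoffel_darboux_kernel_diag hν hw hmN hq0 hq1 hrec horth hn y, div_mul_eq_div_div, div_self hhn.ne']

/-- **The mass of every point is at most the Christoffel function (closed form)**: for a positive discrete measure whose orthogonal polynomials obey the recurrence `(a, b)` up to degree
`n + 1 < N`: `ν{y} ≤ h_n ∕ (q_{n+1}′(y) q_n(y) − q_n′(y) q_{n+1}(y))` for every real `y`. [Akhiezer Thm 2.5.3; Szegő Thm 3.1.3; this file, §1064] -/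
theorem atom_mass_le_christoffel_closed_form {N m : ℕ} {ν w : Fin N → ℝ} (hν : ∀ l, 0 < ν l) (hw : Function.Injective w) (hmN : m < N) {q : ℕ → ℝ[X]} {a b : ℕ → ℝ} (hq0 : q 0 = 1)
    (hq1 : q 1 = Polynomial.X - C (a 0)) (hrec : ∀ n, q (n + 2) = (Polynomial.X - C (a (n + 1))) * q (n + 1) - C (b (n + 1)) * q n)
    (horth : ∀ k, k ≤ m → ∀ G : ℝ[X], G.natDegree < k → ∑ l, ν l * (q k * G).eval (w l) = 0) {n : ℕ} (hn : n + 1 ≤ m) (y : ℝ) :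
    ∑ l ∈ Finset.univ.filter (fun l => w l = y), ν l ≤
      (∑ l, ν l * ((q n).eval (w l)) ^ 2) / ((derivative (q (n + 1))).eval y * (q n).eval y - (derivative (q n)).eval y * (q (n + 1)).eval y) := by
  have hmd := recurrence_monic_natDegree hq0 hq1 hrec
  have hK := atom_mass_mul_kernel_le_one hν hw (by omega : n < N) hq0 (fun k _ => (hmd k).1) (fun k _ => (hmd k).2) (fun k hk => horth k (by omega)) y
  rw [kernelPoly_eval_self_eq] at hK
  have hKpos : 0 < ∑ k ∈ Finset.range (n + 1), ((q k).eval y) ^ 2 / ∑ l, ν l * ((q k).eval (w l)) ^ 2 := by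
    rw [← kernelPoly_eval_self_eq]
    exact kernelPoly_eval_self_pos hν hw (by omega) hq0 (fun k _ => (hmd k).1) (fun k _ => (hmd k).2) y
  rw [← christoffel_function_closed_form hν hw hmN hq0 hq1 hrec horth hn y, le_div_iff₀ hKpos]
  exact hK

end Summit.Ventures.HSemireg.Wedge.HankelOuter
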